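import Summits.Ventures.QEC.Thresholds.CSSFamilyMWPMThresholds
import Summits.Ventures.QEC.Thresholds.DepolarizingThresholds
import Literature.InformationTheory.QuantumCodes.RotatedSurfaceCodeDistance
import Literature.InformationTheory.QuantumCodes.PlanarSurfaceCodeAnisotropic
import HarnessLib

/-!
# Certified thresholds of the ROTATED surface codes `RSC(L) = [[L², 1, L]]` (the Surface-17/49/97 layout): code capacity
# `p₀(3) > .0285` both sectors, loss `≥ 1/3`, noisy measurement `p₀(5) > .0101`, depolarizing `> .0427` — unconditional, KERNEL

Venture QEC, `Summits/Ventures/QEC/Thresholds/` (LADDER-QEC rung Q5, PARTITION row 09; qec-type-09 gen 6, cell item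
«09.RSCTH»). type-08's `RotatedSurfaceCode.lean` / `RotatedSurfaceCodeDistance.lean` (item 08.RSC) construct the rotated
surface code `RotatedSurface.code L` on the `L × L` grid (`X`-faces `(a', b)` with `a' + b` odd, `Z`-faces `(a, b')` with
`a + b'` even, check matrices `RotatedSurface.HX L` / `HZ L`) and prove `k = 1`, `d_Z = d_X = L` (`code_dZ`, `code_dX`).
This file feeds the family `rscCode i = RotatedSurface.code (i + 1)` (`L = i + 1 ≥ 1`) to the census family theorems of
`CSSFamilyThresholds.lean` / `CSSFamilyMWPMThresholds.lean` / `DepolarizingThresholds.lean` (Dumer–Kovalev–Pryadko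
cluster expansion): the only new ingredients are the CHECK WEIGHTS `≤ 4` (`card_rowSupp_HX_le`, `card_rowSupp_HZ_le`: a face
meets the `2 × 2` box of its rows and columns), the COLUMN WEIGHTS `≤ 2` (`card_colSupp_HX_le`, `card_colSupp_HZ_le`: a
qubit lies on at most two faces of each colour — the colour parity), and the growth `L²·r^L → 0`.

| theorem | statement | tier |
|---|---|---|
| `rsc_z_isThresholdLowerBound`, `rsc_x_isThresholdLowerBound`, `rsc_z_accuracyThreshold_gt_0285`, `rsc_x_accuracyThreshold_gt_0285` | code capacity, EVERY minimum-weight decoder family, both sectors: threshold `≥ p₀(3)`, **`p_c > .0285`** | CERTIFIED (kernel), unconditional |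
| `rsc_z_mwpm_isThresholdLowerBound`, `exists_rsc_mwpm_family` | the same for every boundary-MWPM family (the checks are graphlike with boundary: column weight `≤ 2`); non-vacuity | CERTIFIED (kernel), unconditional |
| `rsc_z_erasure_isThresholdLowerBound`, `rsc_x_erasure_isThresholdLowerBound` | loss threshold `≥ 1/3`, both sectors | CERTIFIED (kernel), unconditional |
| `rsc_z_phenom_isThresholdLowerBound`, `rsc_x_phenom_isThresholdLowerBound`, `rsc_z_phenom_accuracyThreshold_gt_0101`, `rsc_z_phenom_mwpm_isThresholdLowerBound` | `T(i)` noisy rounds (`q = p`, polynomially bounded), every minimum-weight space-time decoder family: `≥ p₀(5)`, **`p_c > .0101`** | CERTIFIED (kernel), unconditional |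
| `rsc_depolarizing_isThresholdLowerBound`, `rsc_depolarizing_accuracyThreshold_gt_0427` | depolarizing noise, sector-wise minimum-weight decoding: `≥ (3/2)·p₀(3)`, **`p_c^depol > .0427`** | CERTIFIED (kernel), unconditional |

HONEST FRAMING: cluster-expansion constants (the self-avoiding-walk route `p₀(μ) > .0357` of the planar surface codes,
`PlanarSurfaceCodeSAWThresholds.lean`, needs the rotated lattice's own crossing-path geometry and is not claimed here);
certified LOWER bounds on code-capacity / phenomenological thresholds of the abstract decoding problems — the experimental
and circuit-level numbers quoted for Surface-17/49/97 are different objects and are not asserted. No `native_decide`, no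
named fact, axioms standard.

## References

* [BombinMartinDelgado2007Optimal] H. Bombin, M. A. Martin-Delgado, PRA 76 (2007) 012305, arXiv:quant-ph/0703272, §IV
  (the planar surface code family with `n/d² = 1`).
* [TomitaSvore2014] Y. Tomita, K. M. Svore, PRA 90 (2014) 062320, arXiv:1404.3747, §2.2 (Surface-17, the rotated layout).
* [DumerKovalevPryadko2015] I. Dumer, A. A. Kovalev, L. P. Pryadko, PRL 115 (2015) 050502, Thms 2–3 and p. 5 (`w → w + 2`).
* [DennisEtAl2002] E. Dennis, A. Kitaev, A. Landahl, J. Preskill, J. Math. Phys. 43 (2002) 4452, §3.2, §4.1, §5.3.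
* [KorteVygen2002] B. Korte, J. Vygen, *Combinatorial Optimization*, §12.2 Thm 12.9 (minimum-weight perfect matching).
-/

noncomputable section

namespace Summit.Ventures.QEC.Thresholds

open Filter Topology Finset Matrix
open Literature.InformationTheory.QuantumCodes
open Literature.InformationTheory.QuantumCodes.RotatedSurface

/-! ### The family and its combinatorial data -/

/-- **The rotated surface code family** `i ↦ RSC(i+1)` (`L = i + 1 ≥ 1`: `[[L², 1, L]]`). Definition (reducible).
[cite: BombinMartinDelgado2007Optimal, §IV (n/d² = 1)] -/
abbrev rscCode (i : ℕ) : CSSCode (Fin (i + 1 + 1) × Fin (i + 1 - 1)) (Fin (i + 1 - 1) × Fin (i + 1 + 1))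
    (Fin (i + 1) × Fin (i + 1)) :=
  RotatedSurface.code (i + 1)

/-- A subset of `Fin n` whose values lie in a two-element set of naturals has at most two elements. [folklore] -/
private theorem card_filter_val_le_two {n : ℕ} (u v : ℕ) (P : Fin n → Prop) [DecidablePred P]
    (hP : ∀ i, P i → i.val = u ∨ i.val = v) : (univ.filter P).card ≤ 2 := by
  calc (univ.filter P).card ≤ ({u, v} : Finset ℕ).card := by
        refine Finset.card_le_card_of_injOn Fin.val (fun i hi => ?_) (fun i _ j _ h => Fin.ext h)
        rw [Finset.coe_filter] at hi
        rcases hP i hi.2 with h | h <;> simp [h]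
    _ ≤ 2 := Finset.card_le_two

/-- **The `X`-checks of `RSC(L)` have weight `≤ 4`**: the face `(a', b)` meets only the qubits of the rows `{a'-1, a'}` and
the columns `{b, b+1}`. [cite: TomitaSvore2014, §2.2 (weight-4 bulk and weight-2 boundary stabilizers of the rotated layout)] -/
theorem card_rowSupp_HX_le (L : ℕ) (x : Fin (L + 1) × Fin (L - 1)) : (rowSupp (HX L) x).card ≤ 4 := by
  classical
  set A := univ.filter (fun i : Fin L => i.val + 1 = x.1.val ∨ i.val = x.1.val) with hA
  set B := univ.filter (fun j : Fin L => j.val = x.2.val ∨ j.val = x.2.val + 1) with hB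
  have hsub : rowSupp (HX L) x ⊆ A ×ˢ B := by
    intro q hq
    rw [rowSupp, Finset.mem_filter] at hq
    have h := hq.2
    simp only [HX, vx, rx, cx, mul_ne_zero_iff] at h
    rw [Finset.mem_product, hA, hB, Finset.mem_filter, Finset.mem_filter]
    refine ⟨⟨Finset.mem_univ _, ?_⟩, ⟨Finset.mem_univ _, ?_⟩⟩
    · by_contra hc
      exact h.2.1 (by rw [if_neg hc])
    · by_contra hc
      exact h.2.2 (by rw [if_neg hc])
  have hA2 : A.card ≤ 2 := card_filter_val_le_two (x.1.val - 1) x.1.val _ fun i hi => by omega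
  have hB2 : B.card ≤ 2 := card_filter_val_le_two x.2.val (x.2.val + 1) _ fun j hj => by omega
  calc (rowSupp (HX L) x).card ≤ (A ×ˢ B).card := Finset.card_le_card hsub
    _ = A.card * B.card := Finset.card_product _ _
    _ ≤ 2 * 2 := Nat.mul_le_mul hA2 hB2

/-- **The `Z`-checks of `RSC(L)` have weight `≤ 4`** (rows `{a, a+1}`, columns `{b'-1, b'}`).
[cite: TomitaSvore2014, §2.2 (weight-4 bulk and weight-2 boundary stabilizers)] -/
theorem card_rowSupp_HZ_le (L : ℕ) (z : Fin (L - 1) × Fin (L + 1)) : (rowSupp (HZ L) z).card ≤ 4 := by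
  classical
  set A := univ.filter (fun i : Fin L => i.val = z.1.val ∨ i.val = z.1.val + 1) with hA
  set B := univ.filter (fun j : Fin L => j.val + 1 = z.2.val ∨ j.val = z.2.val) with hB
  have hsub : rowSupp (HZ L) z ⊆ A ×ˢ B := by
    intro q hq
    rw [rowSupp, Finset.mem_filter] at hq
    have h := hq.2
    simp only [HZ, vz, rz, cz, mul_ne_zero_iff] at h
    rw [Finset.mem_product, hA, hB, Finset.mem_filter, Finset.mem_filter]
    refine ⟨⟨Finset.mem_univ _, ?_⟩, ⟨Finset.mem_univ _, ?_⟩⟩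
    · by_contra hc
      exact h.2.1 (by rw [if_neg hc])
    · by_contra hc
      exact h.2.2 (by rw [if_neg hc])
  have hA2 : A.card ≤ 2 := card_filter_val_le_two z.1.val (z.1.val + 1) _ fun i hi => by omega
  have hB2 : B.card ≤ 2 := card_filter_val_le_two (z.2.val - 1) z.2.val _ fun j hj => by omega
  calc (rowSupp (HZ L) z).card ≤ (A ×ˢ B).card := Finset.card_le_card hsub
    _ = A.card * B.card := Finset.card_product _ _
    _ ≤ 2 * 2 := Nat.mul_le_mul hA2 hB2

/-- **Every qubit lies on at most two `X`-faces**: the candidate faces `(a', b)` with `a' ∈ {i, i+1}`, `b ∈ {j-1, j}` of the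
qubit `(i, j)` have alternating colour, so at most two are `X`-faces, and they have different row index (column weight
`≤ 2`: the `X`-checks are graphlike with boundary). [cite: TomitaSvore2014, §2.2 (each data qubit of the rotated layout is in at most two X and two Z stabilizers)] -/
theorem card_colSupp_HX_le (L : ℕ) (q : Fin L × Fin L) : (colSupp (HX L) q).card ≤ 2 := by
  classical
  have hmem : ∀ x ∈ colSupp (HX L) q, (x.1.val + x.2.val) % 2 = 1 ∧ (q.1.val + 1 = x.1.val ∨ q.1.val = x.1.val) ∧
      (q.2.val = x.2.val ∨ q.2.val = x.2.val + 1) := by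
    intro x hx
    rw [colSupp, Finset.mem_filter] at hx
    have h := hx.2
    simp only [HX, vx, rx, cx, mul_ne_zero_iff] at h
    refine ⟨?_, ?_, ?_⟩
    · by_contra hc; exact h.1 (by rw [if_neg hc])
    · by_contra hc; exact h.2.1 (by rw [if_neg hc])
    · by_contra hc; exact h.2.2 (by rw [if_neg hc])
  calc (colSupp (HX L) q).card ≤ ({q.1.val, q.1.val + 1} : Finset ℕ).card := by
        refine Finset.card_le_card_of_injOn (fun x => x.1.val) (fun x hx => ?_) (fun x hx x' hx' h => ?_)
        · obtain ⟨-, h2, -⟩ := hmem x hx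
          rcases h2 with h | h <;> simp [← h]
        · obtain ⟨h1, h2, h3⟩ := hmem x hx
          obtain ⟨h1', h2', h3'⟩ := hmem x' hx'
          simp only at h
          have h22 : x.2.val = x'.2.val := by omega
          exact Prod.ext (Fin.ext h) (Fin.ext h22)
    _ ≤ 2 := Finset.card_le_two

/-- **Every qubit lies on at most two `Z`-faces** (column weight `≤ 2` for `HZ`). [cite: TomitaSvore2014, §2.2] -/
theorem card_colSupp_HZ_le (L : ℕ) (q : Fin L × Fin L) : (colSupp (HZ L) q).card ≤ 2 := by
  classical
  have hmem : ∀ z ∈ colSupp (HZ L) q, (z.1.val + z.2.val) % 2 = 0 ∧ (q.1.val = z.1.val ∨ q.1.val = z.1.val + 1) ∧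
      (q.2.val + 1 = z.2.val ∨ q.2.val = z.2.val) := by
    intro z hz
    rw [colSupp, Finset.mem_filter] at hz
    have h := hz.2
    simp only [HZ, vz, rz, cz, mul_ne_zero_iff] at h
    refine ⟨?_, ?_, ?_⟩
    · by_contra hc; exact h.1 (by rw [if_neg hc])
    · by_contra hc; exact h.2.1 (by rw [if_neg hc])
    · by_contra hc; exact h.2.2 (by rw [if_neg hc])
  calc (colSupp (HZ L) q).card ≤ ({q.2.val, q.2.val + 1} : Finset ℕ).card := by
        refine Finset.card_le_card_of_injOn (fun z => z.2.val) (fun z hz => ?_) (fun z hz z' hz' h => ?_)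
        · obtain ⟨-, -, h3⟩ := hmem z hz
          rcases h3 with h | h <;> simp [← h]
        · obtain ⟨h1, h2, h3⟩ := hmem z hz
          obtain ⟨h1', h2', h3'⟩ := hmem z' hz'
          simp only at h
          have h11 : z.1.val = z'.1.val := by omega
          exact Prod.ext (Fin.ext h11) (Fin.ext h)
    _ ≤ 2 := Finset.card_le_two

/-- Distance hypothesis, `Z`-logicals: weight `≥ L = i + 1` (type-08's `code_dZ`). [cite: DennisEtAl2002, §3.2 (shortest rough-to-rough paths contain L links)] -/
theorem rsc_le_weight_z (i : ℕ) (x : Fin (i + 1) × Fin (i + 1) → ZMod 2) (hx : (rscCode i).HX *ᵥ x = 0)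
    (hxS : x ∉ (rscCode i).rowSpZ) : i + 1 ≤ hammingNorm x :=
  le_weight_of_le_dZ rscCode (d := fun i => i + 1) (fun i => (code_dZ (L := i + 1) (by omega)).symm.le) i x hx hxS

/-- Distance hypothesis, `X`-logicals: weight `≥ L = i + 1` (type-08's `code_dX`). [cite: DennisEtAl2002, §3.2] -/
theorem rsc_le_weight_x (i : ℕ) (x : Fin (i + 1) × Fin (i + 1) → ZMod 2) (hx : (rscCode i).HZ *ᵥ x = 0)
    (hxS : x ∉ (rscCode i).rowSpX) : i + 1 ≤ hammingNorm x :=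
  le_weight_of_le_dX rscCode (d := fun i => i + 1) (fun i => (code_dX (L := i + 1) (by omega)).symm.le) i x hx hxS

/-- **Growth**: `L² · r^L → 0` along `L = i + 1`. [cite: DumerKovalevPryadko2015, Thm 2 (codes of subexponential size in the distance)] -/
theorem rsc_growth (r : ℝ) (hr0 : 0 < r) (hr1 : r < 1) :
    Tendsto (fun i => (Fintype.card (Fin (i + 1) × Fin (i + 1)) : ℝ) * r ^ (i + 1)) atTop (𝓝 0) := by
  have h0 := tendsto_pow_const_mul_const_pow_of_abs_lt_one 2 (show |r| < 1 by rwa [abs_of_nonneg hr0.le])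
  have h1 : Tendsto (fun i : ℕ => ((i + 1 : ℕ) : ℝ) ^ 2 * r ^ (i + 1)) atTop (𝓝 0) :=
    (Filter.tendsto_add_atTop_iff_nat 1).2 h0
  refine h1.congr fun i => ?_
  simp only [Fintype.card_prod, Fintype.card_fin]
  push_cast
  ring

/-- **Growth with noisy rounds**: `(L² + (L+1)(L-1))·T(i)·r^L → 0` for a polynomially bounded schedule (`X`-checks).
[cite: DennisEtAl2002, §5.3 (T increasing no faster than a polynomial of L)] -/
theorem rsc_phenom_growth_z {T : ℕ → ℕ} (hT : ToricCode.IsPolyBounded T) (r : ℝ) (hr0 : 0 < r) (hr1 : r < 1) :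
    Tendsto (fun i => (((Fintype.card (Fin (i + 1) × Fin (i + 1)) + Fintype.card (Fin (i + 1 + 1) × Fin (i + 1 - 1)))
      * T i : ℕ) : ℝ) * r ^ (i + 1)) atTop (𝓝 0) := by
  obtain ⟨A, m, hAm⟩ := hT
  have hA0 : 0 ≤ A := by
    have h := hAm 0
    simp only [Nat.cast_zero, zero_add, one_pow, mul_one] at h
    exact le_trans (Nat.cast_nonneg _) h
  have h0 := tendsto_pow_const_mul_const_pow_of_abs_lt_one (m + 2) (show |r| < 1 by rwa [abs_of_nonneg hr0.le])
  have h1 : Tendsto (fun i : ℕ => ((i + 1 : ℕ) : ℝ) ^ (m + 2) * r ^ (i + 1)) atTop (𝓝 0) :=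
    (Filter.tendsto_add_atTop_iff_nat 1).2 h0
  have h2 := h1.const_mul (3 * A)
  rw [mul_zero] at h2
  refine squeeze_zero (fun i => by positivity) (fun i => ?_) h2
  have hrk : 0 ≤ r ^ (i + 1) := pow_nonneg hr0.le _
  have hsize : (((Fintype.card (Fin (i + 1) × Fin (i + 1)) + Fintype.card (Fin (i + 1 + 1) × Fin (i + 1 - 1)))
      * T i : ℕ) : ℝ) ≤ 3 * A * ((i + 1 : ℕ) : ℝ) ^ (m + 2) := by
    simp only [Fintype.card_prod, Fintype.card_fin, Nat.add_sub_cancel]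
    have hTi := hAm i
    have hT0 : 0 ≤ (T i : ℝ) := Nat.cast_nonneg _
    have hpoly : (((i + 1) * (i + 1) + (i + 1 + 1) * i : ℕ) : ℝ) ≤ 3 * ((i + 1 : ℕ) : ℝ) ^ 2 := by
      push_cast
      nlinarith [(Nat.cast_nonneg i : (0 : ℝ) ≤ i)]
    calc ((((i + 1) * (i + 1) + (i + 1 + 1) * i) * T i : ℕ) : ℝ)
        = (((i + 1) * (i + 1) + (i + 1 + 1) * i : ℕ) : ℝ) * (T i : ℝ) := by push_cast; ring
      _ ≤ 3 * ((i + 1 : ℕ) : ℝ) ^ 2 * (A * ((i : ℝ) + 1) ^ m) := mul_le_mul hpoly hTi hT0 (by positivity)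
      _ = 3 * A * ((i + 1 : ℕ) : ℝ) ^ (m + 2) := by push_cast; ring
  calc _ ≤ 3 * A * ((i + 1 : ℕ) : ℝ) ^ (m + 2) * r ^ (i + 1) := mul_le_mul_of_nonneg_right hsize hrk
    _ = 3 * A * (((i + 1 : ℕ) : ℝ) ^ (m + 2) * r ^ (i + 1)) := by ring

/-- The same growth for the `Z`-checks (`(L-1)(L+1)` of them). [cite: DennisEtAl2002, §5.3] -/
theorem rsc_phenom_growth_x {T : ℕ → ℕ} (hT : ToricCode.IsPolyBounded T) (r : ℝ) (hr0 : 0 < r) (hr1 : r < 1) :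
    Tendsto (fun i => (((Fintype.card (Fin (i + 1) × Fin (i + 1)) + Fintype.card (Fin (i + 1 - 1) × Fin (i + 1 + 1)))
      * T i : ℕ) : ℝ) * r ^ (i + 1)) atTop (𝓝 0) := by
  refine (rsc_phenom_growth_z hT r hr0 hr1).congr fun i => ?_
  simp only [Fintype.card_prod, Fintype.card_fin, Nat.mul_comm (i + 1 + 1) (i + 1 - 1)]

/-! ### Code capacity: `p₀(3)` in both sectors, minimum weight and boundary MWPM -/

/-- ★ **Rotated surface codes, `Z`-sector code-capacity threshold `≥ p₀(3) = (3-2√2)/6 ≈ .0286`** for EVERY minimum-weight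
decoder family of the `X`-syndrome — UNCONDITIONAL, tier CERTIFIED (kernel). [cite: DumerKovalevPryadko2015, Thm 2 (y = 0, w = 4)] -/
theorem rsc_z_isThresholdLowerBound (D : ∀ i, Decoder (Fin (i + 1 + 1) × Fin (i + 1 - 1) → ZMod 2) (Fin (i + 1) × Fin (i + 1) → ZMod 2))
    (hD : ∀ i, (D i).IsMinWeight (rscCode i).zSyndrome ((rscCode i).kerX : Set _) hammingNorm) :
    IsThresholdLowerBound (zFailureFamily rscCode D) (thresholdValue 3) := by
  have h := z_isThresholdLowerBound_of_rowWeight rscCode D hD (w := 4) (by norm_num)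
    (fun i x => card_rowSupp_HX_le (i + 1) x) (fun i => i + 1) (fun i => by omega) rsc_le_weight_z rsc_growth
  norm_num at h
  exact h

/-- ★ **`X`-sector code-capacity threshold `≥ p₀(3)`** for every minimum-weight decoder family of the `Z`-syndrome —
UNCONDITIONAL, tier CERTIFIED (kernel). [cite: DumerKovalevPryadko2015, Thm 2 (y = 0, w = 4)] -/
theorem rsc_x_isThresholdLowerBound (D : ∀ i, Decoder (Fin (i + 1 - 1) × Fin (i + 1 + 1) → ZMod 2) (Fin (i + 1) × Fin (i + 1) → ZMod 2))
    (hD : ∀ i, (D i).IsMinWeight (rscCode i).xSyndrome ((rscCode i).kerZ : Set _) hammingNorm) :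
    IsThresholdLowerBound (xFailureFamily rscCode D) (thresholdValue 3) := by
  have h := x_isThresholdLowerBound_of_rowWeight rscCode D hD (w := 4) (by norm_num)
    (fun i z => card_rowSupp_HZ_le (i + 1) z) (fun i => i + 1) (fun i => by omega) rsc_le_weight_x rsc_growth
  norm_num at h
  exact h

/-- **`p_c > .0285`** (`Z` sector, every minimum-weight decoder family of the rotated surface codes). [cite: DumerKovalevPryadko2015, p. 5 (p_c* ≈ 0.029 for weight-4 codes)] -/
theorem rsc_z_accuracyThreshold_gt_0285
    (D : ∀ i, Decoder (Fin (i + 1 + 1) × Fin (i + 1 - 1) → ZMod 2) (Fin (i + 1) × Fin (i + 1) → ZMod 2))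
    (hD : ∀ i, (D i).IsMinWeight (rscCode i).zSyndrome ((rscCode i).kerX : Set _) hammingNorm) :
    (0.0285 : ℝ) < accuracyThreshold (zFailureFamily rscCode D) :=
  lt_of_lt_of_le thresholdValue_three_bounds.1
    (le_accuracyThreshold (rsc_z_isThresholdLowerBound D hD) ((thresholdValue_le_half 3).trans (by norm_num)))

/-- **`p_c > .0285`** (`X` sector, every minimum-weight decoder family). [cite: DumerKovalevPryadko2015, p. 5] -/
theorem rsc_x_accuracyThreshold_gt_0285
    (D : ∀ i, Decoder (Fin (i + 1 - 1) × Fin (i + 1 + 1) → ZMod 2) (Fin (i + 1) × Fin (i + 1) → ZMod 2))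
    (hD : ∀ i, (D i).IsMinWeight (rscCode i).xSyndrome ((rscCode i).kerZ : Set _) hammingNorm) :
    (0.0285 : ℝ) < accuracyThreshold (xFailureFamily rscCode D) :=
  lt_of_lt_of_le thresholdValue_three_bounds.1
    (le_accuracyThreshold (rsc_x_isThresholdLowerBound D hD) ((thresholdValue_le_half 3).trans (by norm_num)))

/-- Canonical instances: minimum-weight decoding of both syndromes of the rotated surface codes has `p_c > .0285` in both
sectors. [cite: DumerKovalevPryadko2015, Thm 2 (y = 0, w = 4)] -/
theorem rsc_accuracyThreshold_minWeight_gt_0285 :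
    (0.0285 : ℝ) < accuracyThreshold (zFailureFamily rscCode fun i =>
        Decoder.minWeight (rscCode i).zSyndrome hammingNorm) ∧
      (0.0285 : ℝ) < accuracyThreshold (xFailureFamily rscCode fun i =>
        Decoder.minWeight (rscCode i).xSyndrome hammingNorm) :=
  ⟨rsc_z_accuracyThreshold_gt_0285 _ fun i => (rscCode i).isMinWeight_minWeight_zSyndrome,
    rsc_x_accuracyThreshold_gt_0285 _ fun i => (rscCode i).isMinWeight_minWeight_xSyndrome⟩

/-- ★ **Boundary-MWPM attains `p₀(3)` on the rotated surface codes** (`Z` sector): for every graphlike-with-boundary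
presentation `ι i` of `HX (i+1)` (they exist, `card_colSupp_HX_le`), every link metric and every matching decoder —
UNCONDITIONAL, tier CERTIFIED (kernel). [cite: KorteVygen2002, §12.2 Thm 12.9] [cite: DumerKovalevPryadko2015, Thm 2 (y = 0, w = 4)] -/
theorem rsc_z_mwpm_isThresholdLowerBound {ι : ∀ i, Fin (i + 1) × Fin (i + 1) → Sym2 (Option (Fin (i + 1 + 1) × Fin (i + 1 - 1)))}
    (hι : ∀ i, IsGraphlikeVia (rscCode i).HX (ι i)) (m : ∀ i, EdgeMetric (ι i))
    {D' : ∀ i, Decoder (Option (Fin (i + 1 + 1) × Fin (i + 1 - 1)) → ZMod 2) (Fin (i + 1) × Fin (i + 1) → ZMod 2)}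
    (hD : ∀ i, IsMatchingDecoder (m i) (D' i)) :
    IsThresholdLowerBound (zFailureFamily rscCode fun i => boundaryDecoder (D' i)) (thresholdValue 3) :=
  rsc_z_isThresholdLowerBound _ fun i => isMinWeight_boundaryDecoder (hι i) (hD i)

/-- **Non-vacuity**: boundary-MWPM families of the rotated surface codes exist (code capacity and space-time), since every
qubit lies on at most two `X`-faces. [cite: KorteVygen2002, §12.2 Thm 12.9 with Prop 12.6] -/
theorem exists_rsc_mwpm_family (T : ℕ → ℕ) :
    ∃ (ι : ∀ i, Fin (i + 1) × Fin (i + 1) → Sym2 (Option (Fin (i + 1 + 1) × Fin (i + 1 - 1))))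
      (D' : ∀ i, Decoder (Option (Fin (i + 1 + 1) × Fin (i + 1 - 1)) → ZMod 2) (Fin (i + 1) × Fin (i + 1) → ZMod 2))
      (DT' : ∀ i, Decoder (Option ((Fin (i + 1 + 1) × Fin (i + 1 - 1)) × Fin (T i + 1)) → ZMod 2)
        (HistoryLoc (Fin (i + 1) × Fin (i + 1)) (Fin (i + 1 + 1) × Fin (i + 1 - 1)) (T i) → ZMod 2)),
      (∀ i, IsGraphlikeVia (rscCode i).HX (ι i)) ∧ (∀ i, IsMatchingDecoder (extMetric (ι i)) (D' i)) ∧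
        ∀ i, IsMatchingDecoder (extMetric (stEndsOf (ι i) (T i))) (DT' i) :=
  exists_boundary_mwpm_family rscCode T fun i q => card_colSupp_HX_le (i + 1) q

/-! ### Losses: `1/3` in both sectors -/

/-- **Loss threshold `≥ 1/3`**, `Z` sector. [cite: DumerKovalevPryadko2015, Thm 2 (erasure part, w = 4)] -/
theorem rsc_z_erasure_isThresholdLowerBound : IsThresholdLowerBound (zErasureFamily rscCode) (1 / 3) := by
  have h := z_erasure_isThresholdLowerBound_of_rowWeight rscCode (w := 4) (by norm_num)
    (fun i x => card_rowSupp_HX_le (i + 1) x) (fun i => i + 1) (fun i => by omega) rsc_le_weight_z rsc_growth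
  norm_num at h
  exact h

/-- **Loss threshold `≥ 1/3`**, `X` sector. [cite: DumerKovalevPryadko2015, Thm 2 (erasure part, w = 4)] -/
theorem rsc_x_erasure_isThresholdLowerBound : IsThresholdLowerBound (xErasureFamily rscCode) (1 / 3) := by
  have h := x_erasure_isThresholdLowerBound_of_rowWeight rscCode (w := 4) (by norm_num)
    (fun i z => card_rowSupp_HZ_le (i + 1) z) (fun i => i + 1) (fun i => by omega) rsc_le_weight_x rsc_growth
  norm_num at h
  exact h

/-! ### Noisy syndrome measurement (`q = p`): `p₀(5)` in both sectors -/

/-- ★ **Phenomenological threshold `≥ p₀(5) = (5-2√6)/10 ≈ .0101`** (`Z` sector, `q = p`, every polynomially bounded schedule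
of rounds, EVERY minimum-weight space-time decoder family) — UNCONDITIONAL, tier CERTIFIED (kernel).
[cite: DumerKovalevPryadko2015, Thm 3 with p. 5 (w → w + 2)] -/
theorem rsc_z_phenom_isThresholdLowerBound {T : ℕ → ℕ} (hT : ToricCode.IsPolyBounded T)
    (D : ∀ i, CSSPhenom.STDecoder (Fin (i + 1 + 1) × Fin (i + 1 - 1)) (Fin (i + 1) × Fin (i + 1)) (T i))
    (hD : ∀ i, (D i).IsMinWeight (CSSPhenom.stSyn (rscCode i).HX (T i)) (CSSPhenom.stCycles (rscCode i).HX (T i))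
      hammingNorm) :
    IsThresholdLowerBound (zPhenomFailureFamily rscCode T D) (thresholdValue 5) := by
  have h := z_phenom_isThresholdLowerBound_of_rowWeight rscCode T D hD (w := 4)
    (fun i x => card_rowSupp_HX_le (i + 1) x) (fun i => i + 1) (fun i => by omega) rsc_le_weight_z
    (rsc_phenom_growth_z hT)
  norm_num at h
  exact h

/-- **Phenomenological threshold `≥ p₀(5)`**, `X` sector (`Z` record). [cite: DumerKovalevPryadko2015, Thm 3 with p. 5 (w → w + 2)] -/
theorem rsc_x_phenom_isThresholdLowerBound {T : ℕ → ℕ} (hT : ToricCode.IsPolyBounded T)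
    (D : ∀ i, CSSPhenom.STDecoder (Fin (i + 1 - 1) × Fin (i + 1 + 1)) (Fin (i + 1) × Fin (i + 1)) (T i))
    (hD : ∀ i, (D i).IsMinWeight (CSSPhenom.stSyn (rscCode i).HZ (T i)) (CSSPhenom.stCycles (rscCode i).HZ (T i))
      hammingNorm) :
    IsThresholdLowerBound (xPhenomFailureFamily rscCode T D) (thresholdValue 5) := by
  have h := x_phenom_isThresholdLowerBound_of_rowWeight rscCode T D hD (w := 4)
    (fun i z => card_rowSupp_HZ_le (i + 1) z) (fun i => i + 1) (fun i => by omega) rsc_le_weight_x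
    (rsc_phenom_growth_x hT)
  norm_num at h
  exact h

/-- **Space-time boundary-MWPM attains `p₀(5)` on the rotated surface codes** (`Z` sector, `q = p`, schedule `T`): every
graphlike-with-boundary presentation of `HX`, every link metric on the space-time checks, every matching decoder —
UNCONDITIONAL, tier CERTIFIED (kernel). [cite: KorteVygen2002, §12.2 Thm 12.9] [cite: DumerKovalevPryadko2015, Thm 3 with p. 5 (w → w + 2)] -/
theorem rsc_z_phenom_mwpm_isThresholdLowerBound {T : ℕ → ℕ} (hT : ToricCode.IsPolyBounded T)
    {ι : ∀ i, Fin (i + 1) × Fin (i + 1) → Sym2 (Option (Fin (i + 1 + 1) × Fin (i + 1 - 1)))}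
    (hι : ∀ i, IsGraphlikeVia (rscCode i).HX (ι i)) (m : ∀ i, EdgeMetric (stEndsOf (ι i) (T i)))
    {D' : ∀ i, Decoder (Option ((Fin (i + 1 + 1) × Fin (i + 1 - 1)) × Fin (T i + 1)) → ZMod 2)
      (HistoryLoc (Fin (i + 1) × Fin (i + 1)) (Fin (i + 1 + 1) × Fin (i + 1 - 1)) (T i) → ZMod 2)}
    (hD : ∀ i, IsMatchingDecoder (m i) (D' i)) :
    IsThresholdLowerBound (zPhenomFailureFamily rscCode T fun i => boundaryDecoder (D' i)) (thresholdValue 5) :=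
  rsc_z_phenom_isThresholdLowerBound hT _ fun i => isMinWeight_boundaryDecoder_st (hι i) (T i) (hD i)

/-- **`p_c^phenom > .0101`** (`Z` sector, `q = p`, every polynomially bounded schedule, every minimum-weight space-time decoder
family of the rotated surface codes). [cite: DennisEtAl2002, §5.3 eq. (threshold_iso_num) (a lower bound on the accuracy threshold)] -/
theorem rsc_z_phenom_accuracyThreshold_gt_0101 {T : ℕ → ℕ} (hT : ToricCode.IsPolyBounded T)
    (D : ∀ i, CSSPhenom.STDecoder (Fin (i + 1 + 1) × Fin (i + 1 - 1)) (Fin (i + 1) × Fin (i + 1)) (T i))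
    (hD : ∀ i, (D i).IsMinWeight (CSSPhenom.stSyn (rscCode i).HX (T i)) (CSSPhenom.stCycles (rscCode i).HX (T i))
      hammingNorm) :
    (0.0101 : ℝ) < accuracyThreshold (zPhenomFailureFamily rscCode T D) :=
  lt_of_lt_of_le thresholdValue_five_bounds.1
    (le_accuracyThreshold (rsc_z_phenom_isThresholdLowerBound hT D hD) ((thresholdValue_le_half 5).trans (by norm_num)))

/-! ### Depolarizing noise: `(3/2)·p₀(3)` -/

/-- ★ **Depolarizing threshold `≥ (3/2)·p₀(3) = (3-2√2)/4 ≈ .0429`** for the rotated surface codes, decoded sector-wise by ANY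
pair of minimum-weight decoder families — UNCONDITIONAL, tier CERTIFIED (kernel) (the two sector thresholds + the `3/2` rule).
[cite: DennisEtAl2002, §4.1 (depolarizing channel; X and Z errors corrected separately)] [cite: DumerKovalevPryadko2015, Thm 2 (w = 4)] -/
theorem rsc_depolarizing_isThresholdLowerBound
    (DX : ∀ i, Decoder (Fin (i + 1 - 1) × Fin (i + 1 + 1) → ZMod 2) (Fin (i + 1) × Fin (i + 1) → ZMod 2))
    (DZ : ∀ i, Decoder (Fin (i + 1 + 1) × Fin (i + 1 - 1) → ZMod 2) (Fin (i + 1) × Fin (i + 1) → ZMod 2))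
    (hDX : ∀ i, (DX i).IsMinWeight (rscCode i).xSyndrome ((rscCode i).kerZ : Set _) hammingNorm)
    (hDZ : ∀ i, (DZ i).IsMinWeight (rscCode i).zSyndrome ((rscCode i).kerX : Set _) hammingNorm) :
    IsThresholdLowerBound (depolarizingFailureFamily rscCode DX DZ) (3 / 2 * thresholdValue 3) := by
  have h := depolarizing_isThresholdLowerBound rscCode DX DZ (rsc_x_isThresholdLowerBound DX hDX)
    (rsc_z_isThresholdLowerBound DZ hDZ) ((min_le_left _ _).trans (thresholdValue_le_two_thirds _))
  rwa [min_self] at h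

/-- **`p_c^depol > .0427`** (decimal, kernel) for the rotated surface codes under sector-wise minimum-weight decoding.
[cite: DennisEtAl2002, §4.1 and §5.3] -/
theorem rsc_depolarizing_accuracyThreshold_gt_0427
    (DX : ∀ i, Decoder (Fin (i + 1 - 1) × Fin (i + 1 + 1) → ZMod 2) (Fin (i + 1) × Fin (i + 1) → ZMod 2))
    (DZ : ∀ i, Decoder (Fin (i + 1 + 1) × Fin (i + 1 - 1) → ZMod 2) (Fin (i + 1) × Fin (i + 1) → ZMod 2))
    (hDX : ∀ i, (DX i).IsMinWeight (rscCode i).xSyndrome ((rscCode i).kerZ : Set _) hammingNorm)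
    (hDZ : ∀ i, (DZ i).IsMinWeight (rscCode i).zSyndrome ((rscCode i).kerX : Set _) hammingNorm) :
    (0.0427 : ℝ) < accuracyThreshold (depolarizingFailureFamily rscCode DX DZ) := by
  have h3 := thresholdValue_three_bounds.1
  refine lt_of_lt_of_le (by linarith)
    (le_accuracyThreshold (rsc_depolarizing_isThresholdLowerBound DX DZ hDX hDZ) ?_)
  have := thresholdValue_le_half (3 : ℝ)
  linarith

end Summit.Ventures.QEC.Thresholds
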